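import Summits.FinalStateConjecture.FinalStateConjecture.Theses.LateLocalKicks
import Summits.FinalStateConjecture.FinalStateConjecture.Theses.PhotonSphereChannels

/-!
# Census artefact D-T — the "tame handoff" split of `LateKick` (crux-strategist r1, 2026-08-17)

The best TYPED decomposition of `LateLocalKicks.LateKick` (stmt-FinalStateConjecture-17990) found by the
strategist census, recorded with a PROVED assembly so that the census' §Decomposition is concrete:

* `P₁ = LateKickToTame` — `LateKick` with the settling legend `Q` replaced by the TAME-CENSORED legend
  `T` of route PhotonSphereChannels (verbatim the matrix of `TameCensorship` minus its anti-vacuity conjunct: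
  every MGHD has complete `𝓘⁺`, carries no extremal-Kerr remnant, and has C³-bounded outer geometry at a
  uniform scale): every admissible datum failing `T` admits an admissible pinned co-slice carrying a local
  kick all of whose small positive members satisfy `T`.  No Kerr convergence is asserted.
* `P₂ = PhotonSphereChannels.ChannelsResolveTameDevelopmentsR` — the EXISTING item stmt-FinalStateConjecture-17430
  (rank 3 of route PhotonSphereChannels, open, registered skeleton): conditional large-data capture of tame
  censored developments, fed by the PROVED linear input `UniformPhotonSphereChannelsR_holds`.
* Assembly `lateKick_of_tameHandoff : LateKickToTame → ChannelsResolveTameDevelopmentsR → LateKick`, PROVED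
  (no MGHD existence needed): if the exceptional datum is already tame-censored, `P₂` settles it outright
  (contradiction with `¬ Q`); otherwise `P₁` kicks a co-slice into `T` and `P₂` upgrades `T` to `Q` member by
  member, each hole being sub-extremal because `|aᵢ| = Mᵢ` would be an extremal remnant
  (the five-line derivation of `PhotonSphereChannels.closes`).

Why this split is NOT filed with `route edit --split` is argued in STRATEGY-CENSUS.md §Decomposition (D-T):
`P₁` is `TameCensorship` (stmt-17431) in the same costume that makes `LateKick` the summit —
`tameCensorship_of_lateKickToTame` below (the `Q ↦ T` instance of `Costume.lean`'s schema) — and the edited route would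
be dominated by PhotonSphereChannels (its cone ⊇ theirs in strength).
-/

set_option linter.dupNamespace false
set_option maxHeartbeats 800000

noncomputable section

namespace Summit.FinalStateConjecture.FinalStateConjecture.Cruxes.LateKick.CensusDT

open scoped Manifold ContDiff Topology
open Set Filter
open Literature.Geometry.Lorentzian
open Summit.FinalStateConjecture (HasCompleteNullInfinity exteriorOf RaysStayInClosure HasExhaustiveCharts
  IsFutureOriented)
open Summit.FinalStateConjecture.FinalStateConjecture.Theses.LateLocalKicks
  (LateKick KickTransport TameWitnessOfLocalFamily MGHDExists)
open Summit.FinalStateConjecture.FinalStateConjecture.Theses.PhotonSphereChannels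
  (UniformPhotonSphereChannelsR ChannelsResolveTameDevelopmentsR TameCensorship
    UniformPhotonSphereChannelsR_holds)

section Vocabulary

variable (X : Type) [TopologicalSpace X] [ChartedSpace E3 X] [IsManifold (𝓡 3) ∞ X]
  [T2Space X] [SecondCountableTopology X] [ConnectedSpace X]

/-- `T` at one datum — TAME CENSORED: verbatim the post-maximality matrix of `PhotonSphereChannels.TameCensorship`
(every MGHD: complete `𝓘⁺` ∧ no extremal-Kerr remnant ∧ C³-bounded outer geometry at a uniform scale). -/
def TameAt (D : InitialDataSet (𝓡 3) X) : Prop :=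
  ∀ 𝒟 : Literature.Geometry.Lorentzian.VacuumCauchyDevelopment D, 𝒟.IsMaximal →
    _root_.Summit.FinalStateConjecture.HasCompleteNullInfinity 𝒟.toCauchyDevelopment ∧ ((∀ (Λ : Literature.Geometry.Lorentzian.lorentzGroup) (c : Literature.Geometry.Lorentzian.E4) (M a : ℝ), Literature.Geometry.Lorentzian.Kerr.IsExtremal M a → ¬ ∃ (τ₀ : ℝ) (Ψ : (Literature.Geometry.Lorentzian.boostedKerrBackground Λ c M a).domain → 𝒟.carrier), 𝒟.toSpacetime.IsLateChart (Literature.Geometry.Lorentzian.boostedKerrBackground Λ c M a) Set.univ τ₀ Ψ ∧ ∀ R : ℝ, Filter.Tendsto (fun τ => 𝒟.toSpacetime.truncDeviationCk (Literature.Geometry.Lorentzian.boostedKerrBackground Λ c M a) Ψ 2 R τ) Filter.atTop (nhds 0)) ∧ ∀ [𝒟.metric.HasLeviCivita], let outer : Set 𝒟.carrier := 𝒟.metric.causalFuture 𝒟.timeOrientation (Set.range 𝒟.embed) ∩ {q | ∃ (p : X) (γ : ℝ → 𝒟.carrier) (dom : Set ℝ), 𝒟.metric.IsNormalisedNullRayFrom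 𝒟.timeOrientation 𝒟.embed 𝒟.normal p γ dom ∧ ¬ BddAbove dom ∧ q ∈ 𝒟.metric.chronologicalPast 𝒟.timeOrientation (γ '' (dom ∩ Set.Ici 0))}; ∃ r₀ : ℝ, 0 < r₀ ∧ ∃ Λ : NNReal, ∀ q ∈ outer, let U : TopologicalSpace.Opens Literature.Geometry.Lorentzian.E4 := ⟨Metric.ball (0 : Literature.Geometry.Lorentzian.E4) r₀, Metric.isOpen_ball⟩; ∃ Ψ : U → 𝒟.carrier, 𝒟.toSpacetime.IsLateChart (Literature.Geometry.Lorentzian.Minkowski.backgroundOn U) Set.univ (-r₀) Ψ ∧ (∃ x : U, (x : Literature.Geometry.Lorentzian.E4) = 0 ∧ Ψ x = q) ∧ Literature.Geometry.Lorentzian.supCkENorm (U : Set Literature.Geometry.Lorentzian.E4) 3 (𝒟.toSpacetime.deviationExtend (Literature.Geometry.Lorentzian.Minkowski.backgroundOn U) Ψ) ≤ (Λ : ENNReal) ∧ Literature.Geometry.Lorentzian.supCkENorm (U : Set Literature.Geometry.Lorentzian.E4) 0 (𝒟.toSpacetime.deviationExtend (Literature.Geometry.Lorentzian.Minkowski.backgroundOn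 U) Ψ) ≤ 1 / 2)

/-- `Q` at one datum: verbatim the settling legend of route LateLocalKicks. -/
def SettlesAt (D : InitialDataSet (𝓡 3) X) : Prop :=
  ∀ 𝒟 : VacuumCauchyDevelopment D, 𝒟.IsMaximal →
    HasCompleteNullInfinity 𝒟.toCauchyDevelopment ∧
      ∃ (O : Set 𝒟.carrier) (dd : FinalStateDecomposition 𝒟.toSpacetime O 2),
        (∀ i, Kerr.IsSubextremal (dd.mass i) (dd.spin i)) ∧
          O = exteriorOf 𝒟.toCauchyDevelopment dd.charted ∧
            RaysStayInClosure 𝒟.toCauchyDevelopment O ∧ HasExhaustiveCharts dd ∧ IsFutureOriented dd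

end Vocabulary

/-- **Piece P₁ — `LateKickToTame`** (typed as a route item would be: `X` bound inside, the legends `Local`,
`CoSlice` let-bound verbatim as in every item of LateLocalKicks; `T` = `TameAt`). -/
def LateKickToTame : Prop :=
  ∀ (X : Type) [TopologicalSpace X] [ChartedSpace Literature.Geometry.Lorentzian.E3 X] [IsManifold (𝓡 3) ((⊤ : ℕ∞) : WithTop ℕ∞) X] [T2Space X] [SecondCountableTopology X] [ConnectedSpace X], ∀ d ∈ Literature.Geometry.Lorentzian.admissibleVacuumData X, let Local : Literature.Geometry.Lorentzian.InitialDataSet (𝓡 3) X → (EuclideanSpace ℝ (Fin 1) → Literature.Geometry.Lorentzian.InitialDataSet (𝓡 3) X) → Prop := fun D G ↦ Literature.Geometry.Lorentzian.InitialDataSet.IsSmoothDataFamily 1 G ∧ G 0 = D ∧ (∀ c, G c ∈ Literature.Geometry.Lorentzian.admissibleVacuumData X) ∧ ∃ K : Set X, IsCompact K ∧ ∀ c, ∀ x ∉ K, (G c).h.inner x = D.h.inner x ∧ (G c).k x = D.k x; let CoSlice : Literature.Geometry.Lorentzian.InitialDataSet (𝓡 3) X → Literature.Geometry.Lorentzian.InitialDataSet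 (𝓡 3) X → Prop := fun D D' ↦ ∃ (𝒟 : Literature.Geometry.Lorentzian.VacuumCauchyDevelopment D) (𝒟' : Literature.Geometry.Lorentzian.VacuumCauchyDevelopment D') (ψ : 𝒟'.carrier → 𝒟.carrier), ContMDiff (𝓡 4) (𝓡 4) ((⊤ : ℕ∞) : WithTop ℕ∞) ψ ∧ Topology.IsOpenEmbedding ψ ∧ 𝒟'.metric.IsIsometricImmersion 𝒟.metric.toPseudoRiemannianMetric ψ ∧ 𝒟'.timeOrientation.PreservesTimeOrientation ψ 𝒟.timeOrientation ∧ 𝒟.metric.IsCauchyHypersurface 𝒟.timeOrientation (Set.range (ψ ∘ 𝒟'.embed)) ∧ ∃ C : Set X, IsCompact C ∧ ∀ x ∉ C, ψ (𝒟'.embed x) = 𝒟.embed x; ¬ TameAt X d → ∃ d' ∈ Literature.Geometry.Lorentzian.admissibleVacuumData X, CoSlice d d' ∧ ∃ G' : EuclideanSpace ℝ (Fin 1) → Literature.Geometry.Lorentzian.InitialDataSet (𝓡 3) X, Local d' G' ∧ ∃ δ : ℝ, 0 < δ ∧ ∀ c : EuclideanSpace ℝ (Fin 1), 0 < c 0 →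 c 0 < δ → TameAt X (G' c)

/-- Pointwise handoff: on an admissible datum, tame-censored ⇒ settles, by `P₂` fed with the proved `K1R`;
sub-extremality of each hole from `|aᵢ| ≤ Mᵢ` and the no-extremal-remnant clause (verbatim the tail of
`PhotonSphereChannels.closes`). -/
theorem settlesAt_of_tameAt (hK2 : ChannelsResolveTameDevelopmentsR) (X : Type) [TopologicalSpace X]
    [ChartedSpace E3 X] [IsManifold (𝓡 3) ∞ X] [T2Space X] [SecondCountableTopology X] [ConnectedSpace X]
    {D : InitialDataSet (𝓡 3) X} (hD : D ∈ admissibleVacuumData X) (hT : TameAt X D) : SettlesAt X D := by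
  intro 𝒟 hmax
  obtain ⟨hcomp, htame⟩ := hT 𝒟 hmax
  obtain ⟨O, d, hO, hrays, hexh, hfo⟩ := hK2 UniformPhotonSphereChannelsR_holds X D hD 𝒟 hmax hcomp htame
  refine ⟨hcomp, O, d, fun i => ?_, hO, hrays, hexh, hfo⟩
  rcases lt_or_eq_of_le (d.abs_spin_le_mass i) with hlt | heq
  · exact hlt
  · exact absurd ⟨d.τ₀, d.chart i, ⟨(d.isLateChart i).contMDiff, (d.isLateChart i).isOpenEmbedding,
        Set.subset_univ _⟩, d.tendsto_truncDeviationCk i⟩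
      (htame.1 (d.motion i).1 (d.motion i).2 (d.mass i) (d.spin i) ⟨heq, d.mass_pos i⟩)

/-- **Assembly of D-T, PROVED.** `P₁ → P₂ → LateKick`. -/
theorem lateKick_of_tameHandoff (hP₁ : LateKickToTame) (hP₂ : ChannelsResolveTameDevelopmentsR) :
    LateKick := by
  intro X _ _ _ _ _ _ d hd Q Local CoSlice hnQ
  by_cases hT : TameAt X d
  · exact absurd (settlesAt_of_tameAt hP₂ X hd hT) hnQ
  · obtain ⟨d', hd', hco, G', hloc', δ, hδ, hgood⟩ := hP₁ X d hd hT
    exact ⟨d', hd', hco, G', hloc', δ, hδ, fun c hc hcδ ↦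
      settlesAt_of_tameAt hP₂ X (hloc'.2.2.1 c) (hgood c hc hcδ)⟩


/-! ## `P₁` is `TameCensorship` in the same costume (the `Q ↦ T` instance of `Costume.lean`'s schema)

The twins below are the route's `SliceIndependence` / `OneSidedSuffices` with the legend `Q` replaced by `T`
(same known-theorem grade: causal re-anchoring of slice-anchored clauses across a compact lens; compactly
supported gauge shear).  They are NOT filed anywhere; they only make the costume claim a checked theorem. -/

/-- `T` descends along pinned co-slices (twin of `LateLocalKicks.SliceIndependence`, `Q ↦ T`). -/
def TameSliceIndependence : Prop :=
  ∀ (X : Type) [TopologicalSpace X] [ChartedSpace Literature.Geometry.Lorentzian.E3 X] [IsManifold (𝓡 3) ((⊤ : ℕ∞) : WithTop ℕ∞) X] [T2Space X] [SecondCountableTopology X] [ConnectedSpace X], ∀ d ∈ Literature.Geometry.Lorentzian.admissibleVacuumData X, ∀ d' ∈ Literature.Geometry.Lorentzian.admissibleVacuumData X, let CoSlice : Literature.Geometry.Lorentzian.InitialDataSet (𝓡 3) X → Literature.Geometry.Lorentzian.InitialDataSet (𝓡 3) X → Prop := fun D D' ↦ ∃ (𝒟 : Literature.Geometry.Lorentzian.VacuumCauchyDevelopment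 D) (𝒟' : Literature.Geometry.Lorentzian.VacuumCauchyDevelopment D') (ψ : 𝒟'.carrier → 𝒟.carrier), ContMDiff (𝓡 4) (𝓡 4) ((⊤ : ℕ∞) : WithTop ℕ∞) ψ ∧ Topology.IsOpenEmbedding ψ ∧ 𝒟'.metric.IsIsometricImmersion 𝒟.metric.toPseudoRiemannianMetric ψ ∧ 𝒟'.timeOrientation.PreservesTimeOrientation ψ 𝒟.timeOrientation ∧ 𝒟.metric.IsCauchyHypersurface 𝒟.timeOrientation (Set.range (ψ ∘ 𝒟'.embed)) ∧ ∃ C : Set X, IsCompact C ∧ ∀ x ∉ C, ψ (𝒟'.embed x) = 𝒟.embed x; CoSlice d d' → (∃ 𝒟' : Literature.Geometry.Lorentzian.VacuumCauchyDevelopment d', 𝒟'.IsMaximal) → TameAt X d' → TameAt X d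

/-- One-sided local kicks into `T` shear to local immersed window families (twin of
`LateLocalKicks.OneSidedSuffices`, `Q ↦ T`). -/
def TameOneSidedShear : Prop :=
  ∀ (X : Type) [TopologicalSpace X] [ChartedSpace Literature.Geometry.Lorentzian.E3 X] [IsManifold (𝓡 3) ((⊤ : ℕ∞) : WithTop ℕ∞) X] [T2Space X] [SecondCountableTopology X] [ConnectedSpace X], ∀ d ∈ Literature.Geometry.Lorentzian.admissibleVacuumData X, let Local : Literature.Geometry.Lorentzian.InitialDataSet (𝓡 3) X → (EuclideanSpace ℝ (Fin 1) → Literature.Geometry.Lorentzian.InitialDataSet (𝓡 3) X) → Prop := fun D G ↦ Literature.Geometry.Lorentzian.InitialDataSet.IsSmoothDataFamily 1 G ∧ G 0 = D ∧ (∀ c, G c ∈ Literature.Geometry.Lorentzian.admissibleVacuumData X) ∧ ∃ K : Set X, IsCompact K ∧ ∀ c, ∀ x ∉ K, (G c).h.inner x = D.h.inner x ∧ (G c).k x = D.k x; (∃ G : EuclideanSpace ℝ (Fin 1) → Literature.Geometry.Lorentzian.InitialDataSet (𝓡 3) X, Local d G ∧ ∃ δ : ℝ, 0 < δ ∧ ∀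 c : EuclideanSpace ℝ (Fin 1), 0 < c 0 → c 0 < δ → TameAt X (G c)) → ∃ (ε : ℝ) (F : EuclideanSpace ℝ (Fin 1) → Literature.Geometry.Lorentzian.InitialDataSet (𝓡 3) X), 0 < ε ∧ Literature.Geometry.Lorentzian.InitialDataSet.IsSmoothDataFamily 1 F ∧ F 0 = d ∧ Literature.Geometry.Lorentzian.InitialDataSet.IsImmersedAtZero 1 F ∧ (∃ K : Set X, IsCompact K ∧ ∀ c, ∀ x ∉ K, (F c).h.inner x = d.h.inner x ∧ (F c).k x = d.k x) ∧ (∀ c c' : EuclideanSpace ℝ (Fin 1), |c 0| < ε → |c' 0| < ε → F c = F c' → c = c') ∧ (∀ c : EuclideanSpace ℝ (Fin 1), |c 0| < ε → F c ∈ Literature.Geometry.Lorentzian.admissibleVacuumData X) ∧ ∀ c : EuclideanSpace ℝ (Fin 1), c ≠ 0 → |c 0| < ε → TameAt X (F c)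

/-- `PhotonSphereChannels.TameCensorship` (stmt-FinalStateConjecture-17431) is, by `δ`-reduction alone, the
tame genericity of `(∃ MGHD) ∧ T`. -/
theorem tameCensorship_iff :
    TameCensorship ↔ ∀ (X : Type) [TopologicalSpace X] [ChartedSpace E3 X] [IsManifold (𝓡 3) ∞ X]
      [T2Space X] [SecondCountableTopology X] [ConnectedSpace X],
      InitialDataSet.IsTameChristodoulouGeneric (admissibleVacuumData X)
        (fun D ↦ (∃ 𝒟 : VacuumCauchyDevelopment D, 𝒟.IsMaximal) ∧ TameAt X D) 1 :=
  Iff.rfl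

/-- **`P₁` + the same packaging ⇒ `TameCensorship`.**  Modulo kick transport (the route's own item
`KickTransport`), the `Q ↦ T` twins of `SliceIndependence` / `OneSidedSuffices`, the shared packaging item
`TameWitnessOfLocalFamily` and `MGHDExists`, the kick piece `P₁` of D-T implies PhotonSphereChannels' crux
K3 = `TameCensorship` — by the SAME pure logic by which `LateLocalKicks.closes` derives the summit from
`LateKick`.  No converse is known.  Hence `P₁` is K3 with a narrowed witness class (costume one level down). -/
theorem tameCensorship_of_lateKickToTame (hP₁ : LateKickToTame) (hTrans : KickTransport)
    (hSlice : TameSliceIndependence) (hOne : TameOneSidedShear) (hTame : TameWitnessOfLocalFamily)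
    (hMGHD : MGHDExists) : TameCensorship := by
  refine tameCensorship_iff.2 fun X _ _ _ _ _ _ ↦ ?_
  refine hTame X _ ?_
  intro d hdA hnP
  have hnT : ¬ TameAt X d := fun hT ↦ hnP ⟨hMGHD X d hdA, hT⟩
  obtain ⟨d', hd'A, hco, G', hloc', δ', hδ', hgood'⟩ := hP₁ X d hdA hnT
  obtain ⟨G, hloc, δ, hδ, hfam⟩ := hTrans X d hdA d' hd'A hco G' hloc'
  obtain ⟨ε, F, hε, hF, hF0, hFimm, hFK, hFinj, hFA, hFT⟩ := hOne X d hdA ⟨G, hloc,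
    min δ δ', lt_min hδ hδ', fun c hc0 hcδ ↦ hSlice X (G c) (hloc.2.2.1 c) (G' c) (hloc'.2.2.1 c)
      (hfam c (by rw [abs_of_pos hc0]; exact lt_of_lt_of_le hcδ (min_le_left _ _)))
      (hMGHD X (G' c) (hloc'.2.2.1 c)) (hgood' c hc0 (lt_of_lt_of_le hcδ (min_le_right _ _)))⟩
  exact ⟨ε, F, hε, hF, hF0, hFimm, hFK, hFinj, hFA, fun c hc hcε ↦
    ⟨hMGHD X (F c) (hFA c hcε), hFT c hc hcε⟩⟩

end Summit.FinalStateConjecture.FinalStateConjecture.Cruxes.LateKick.CensusDT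

end
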